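import Summits.Ventures.PercRepro.C025ProfilePLDCertificate
import Summits.Ventures.PercRepro.C025ProfilePLDTwoFlat

/-!
# PER-LAYER DOMINANCE FOR «M ⊕ U_{4,8}» FOR EVERY (PLD)-MATROID `M` OF RANK ≤ 10: A LIFTED CERTIFICATE TABLE — PART I (night-3 g35)

`proofs/NIGHT3-G35-BASEMAP.md` §2 (the fast engine of g34, `proofs/NIGHT3-G34-FASTLIFT.md` §1) (the generator of g31, `proofs/NIGHT3-G31-TWOLIFT.md` §4; the certificate lemma of g30, `proofs/NIGHT3-G30-PAREXT.md` §9).  The symmetric-coordinate Farkas certificates of «(PLD)(M) ⇒ (PLD)(M ⊕ U_{4,8})» for profiles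
of rank ≤ 10 (HiGHS vertex + exact rational reconstruction, lab/fastlp.py + certtab_general.py; one list of instances `(lo, hi, δ, Θ, N)` with a common denominator
`D` per canonical target `(lo, hi, δ)`, `lo ≤ hi ≤ 14`, `δ ≤ 14`) verified pointwise on `[0,10]²` by `decide` (`uniform_4_8_table_10_part0`) and fed
to the certificate lemma `PLDCert.sum_le_of_cert`: `pld_disjointSum_uniform_4_8_of_eRank_le_10` — (PLD)(M) ∧ rank M ≤ 10 ⟹ (PLD)(M ⊕ U_{4,8}), the uniform matroid
being `truncate (freeOn F) 4` with `|F| = 8`.  No `def`, no `instance`, no notation.  Axioms: standard.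
-/

open scoped Matroid

namespace PercRepro

open Finset ThmH

namespace PLDTriangle

variable {α : Type} [DecidableEq α]

set_option maxRecDepth 16384 in
set_option maxHeartbeats 256000000 in
/-- THE TABLE (part 16: δ ∈ [8, 8)): a pointwise symmetrised certificate for every canonical target, as a finite computation. -/
theorem uniform_4_8_table_10_part16 :
    ∀ T : ℕ → ℕ → ℕ → ℕ × List (ℕ × ℕ × ℕ × ℕ × ℕ), T = (fun _ _ _ : ℕ => ((1 : ℕ), ([] : List (ℕ × ℕ × ℕ × ℕ × ℕ)))) →
      ∀ lo ∈ range 15, ∀ hi ∈ range 15, ∀ δ ∈ Ico 8 8, lo ≤ hi →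
      0 < (T lo hi δ).1 ∧
      (∀ k ∈ (T lo hi δ).2, k.2.2.2.1 ≤ k.1 + k.2.1 + k.2.2.1 ∧ (k.1 = 0 ∨ k.1 + k.2.1 + k.2.2.1 ≤ k.2.2.2.1)) ∧
      ∀ x ∈ range 11, ∀ f ∈ range 11,
        (T lo hi δ).1 * (∑ i ∈ range 9, Nat.choose 8 i * (if lo ≤ x + min i 4 ∧ x + min i 4 ≤ hi ∧ (if lo = 0 then 0 else lo + hi + δ) ≤ (f + min (8 - i) 4) + (x + min i 4) then (f + min (8 - i) 4).choose δ else 0)) + (T lo hi δ).1 * (∑ i ∈ range 9, Nat.choose 8 i * (if lo ≤ f + min i 4 ∧ f + min i 4 ≤ hi ∧ (if lo = 0 then 0 else lo + hi + δ) ≤ (x + min (8 - i) 4) + (f + min i 4) then (x + min (8 - i) 4).choose δ else 0)) +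
          (((T lo hi δ).2).map (fun k : (ℕ × ℕ × ℕ × ℕ × ℕ) => k.2.2.2.2 *
          ((if k.1 + k.2.2.1 ≤ f ∧ f ≤ k.2.1 + k.2.2.1 then f.choose k.2.2.1 else 0) +
            (if k.1 + k.2.2.1 ≤ x ∧ x ≤ k.2.1 + k.2.2.1 then x.choose k.2.2.1 else 0)))).sum ≤
        (T lo hi δ).1 * (∑ i ∈ range 9, Nat.choose 8 i * (if lo + δ ≤ f + min (8 - i) 4 ∧ f + min (8 - i) 4 ≤ hi + δ then (f + min (8 - i) 4).choose δ else 0)) + (T lo hi δ).1 * (∑ i ∈ range 9, Nat.choose 8 i * (if lo + δ ≤ x + min (8 - i) 4 ∧ x + min (8 - i) 4 ≤ hi + δ then (x + min (8 - i) 4).choose δ else 0)) +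
          (((T lo hi δ).2).map (fun k : (ℕ × ℕ × ℕ × ℕ × ℕ) => k.2.2.2.2 *
          ((if k.1 ≤ x ∧ x ≤ k.2.1 ∧ k.2.2.2.1 ≤ f + x then f.choose k.2.2.1 else 0) +
            (if k.1 ≤ f ∧ f ≤ k.2.1 ∧ k.2.2.2.1 ≤ x + f then x.choose k.2.2.1 else 0)))).sum := by
  intro T hT
  subst hT
  decide

set_option maxRecDepth 16384 in
set_option maxHeartbeats 256000000 in
/-- THE TABLE (part 17: δ ∈ [8, 8)): a pointwise symmetrised certificate for every canonical target, as a finite computation. -/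
theorem uniform_4_8_table_10_part17 :
    ∀ T : ℕ → ℕ → ℕ → ℕ × List (ℕ × ℕ × ℕ × ℕ × ℕ), T = (fun _ _ _ : ℕ => ((1 : ℕ), ([] : List (ℕ × ℕ × ℕ × ℕ × ℕ)))) →
      ∀ lo ∈ range 15, ∀ hi ∈ range 15, ∀ δ ∈ Ico 8 8, lo ≤ hi →
      0 < (T lo hi δ).1 ∧
      (∀ k ∈ (T lo hi δ).2, k.2.2.2.1 ≤ k.1 + k.2.1 + k.2.2.1 ∧ (k.1 = 0 ∨ k.1 + k.2.1 + k.2.2.1 ≤ k.2.2.2.1)) ∧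
      ∀ x ∈ range 11, ∀ f ∈ range 11,
        (T lo hi δ).1 * (∑ i ∈ range 9, Nat.choose 8 i * (if lo ≤ x + min i 4 ∧ x + min i 4 ≤ hi ∧ (if lo = 0 then 0 else lo + hi + δ) ≤ (f + min (8 - i) 4) + (x + min i 4) then (f + min (8 - i) 4).choose δ else 0)) + (T lo hi δ).1 * (∑ i ∈ range 9, Nat.choose 8 i * (if lo ≤ f + min i 4 ∧ f + min i 4 ≤ hi ∧ (if lo = 0 then 0 else lo + hi + δ) ≤ (x + min (8 - i) 4) + (f + min i 4) then (x + min (8 - i) 4).choose δ else 0)) +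
          (((T lo hi δ).2).map (fun k : (ℕ × ℕ × ℕ × ℕ × ℕ) => k.2.2.2.2 *
          ((if k.1 + k.2.2.1 ≤ f ∧ f ≤ k.2.1 + k.2.2.1 then f.choose k.2.2.1 else 0) +
            (if k.1 + k.2.2.1 ≤ x ∧ x ≤ k.2.1 + k.2.2.1 then x.choose k.2.2.1 else 0)))).sum ≤
        (T lo hi δ).1 * (∑ i ∈ range 9, Nat.choose 8 i * (if lo + δ ≤ f + min (8 - i) 4 ∧ f + min (8 - i) 4 ≤ hi + δ then (f + min (8 - i) 4).choose δ else 0)) + (T lo hi δ).1 * (∑ i ∈ range 9, Nat.choose 8 i * (if lo + δ ≤ x + min (8 - i) 4 ∧ x + min (8 - i) 4 ≤ hi + δ then (x + min (8 - i) 4).choose δ else 0)) +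
          (((T lo hi δ).2).map (fun k : (ℕ × ℕ × ℕ × ℕ × ℕ) => k.2.2.2.2 *
          ((if k.1 ≤ x ∧ x ≤ k.2.1 ∧ k.2.2.2.1 ≤ f + x then f.choose k.2.2.1 else 0) +
            (if k.1 ≤ f ∧ f ≤ k.2.1 ∧ k.2.2.2.1 ≤ x + f then x.choose k.2.2.1 else 0)))).sum := by
  intro T hT
  subst hT
  decide

end PLDTriangle

end PercRepro
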